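import Literature.AnabelianGeometry.SemiGraphs.CoveringCellsGaloisAction
import Literature.AnabelianGeometry.SemiGraphs.GraphOfAnabelioidsGalois
import HarnessLib

/-!
# PORT PRODUCTION (d), lift: a double incidence lifts along connected covers over `A`
# ([SemiAnbd] Def. 2.2 (i) p. 23, proof of Cor. 2.7 (i) p. 30)

Mochizuki, *Semi-graphs of anabelioids*, Publ. RIMS **42** (2006), §2: Def. 2.2 (i) p. 23 (cells of
`𝔾_A` = connected components; "a finite étale covering of `B(𝒢)_{G′}` may also be regarded as a finite
étale covering of `B(𝒢)`") and the proof of Cor. 2.7 (i) p. 30 [cite: MochizukiSemiAnbd2006, Def. 2.2(i) p.23].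
PROOF-ONLY (abc-iut cell, layer L3; FACT-LIST row F-1487, CLASS route, brick R6a PORT PRODUCTION (d),
file D2; seat abc-iut-f-161 gen 12; L3-lead ε50).  No definition, no instance, no named fact.

* `doubleIncidence_lift` — for `𝒢` connected, `u : Y → Y₁` between CONNECTED objects of `B(𝒢)` and
  `g₁ : Y₁ → A`: two distinct branch-cells of `𝔾_{Y₁}` with one abutment, both over the edge-cell
  `(e, Q)` of `𝔾_A`, LIFT to two distinct branch-cells of `𝔾_Y` with one abutment, both over `(e, Q)`
  along `u ≫ g₁` (fibre surjectivity of maps onto connected objects; the level-edge dictionary of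
  `LevelEdgesOfObject` in the identity frame `F = b^* ⋙ F_e`).

Nothing here takes a side on [IUTchIII] Cor. 3.12.
-/

namespace Literature.AnabelianGeometry.SemiGraphs.SemiGraphOfAnabelioids.BObj

open CategoryTheory CategoryTheory.Limits CategoryTheory.PreGaloisCategory
open Literature.AnabelianGeometry.Anabelioids

universe v₁ u₁ u

set_option backward.isDefEq.respectTransparency false -- `π₀Obj` coercions, as in `ComponentsReadBack.lean`

variable {𝒢 : SemiGraphOfAnabelioids.{v₁, u₁, u}}

/-- **Double incidences lift along connected covers over `A`** ([SemiAnbd] p. 23/p. 30).  `𝒢` connected,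
`u : Y → Y₁` with `Y`, `Y₁` connected in `B(𝒢)`, `g₁ : Y₁ → A`; if `β ≠ β′` are branch-cells of `𝔾_{Y₁}`
with the same abutment, both over the edge-cell `(e, Q)` of `𝔾_A` along `g₁`, then `𝔾_Y` has
branch-cells `γ ≠ γ′` over the same branches, with one abutment, both over `(e, Q)` along `u ≫ g₁`.
(Choose a vertex-cell `p̃` of `𝔾_Y` over the common end `p`; the map `p̃ → p` of connected objects is
fibre-surjective, so the level edges `β`, `β′` are level edges of points of `p̃`.)
[cite: MochizukiSemiAnbd2006, Def. 2.2(i) p.23] -/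
theorem doubleIncidence_lift [GaloisCategory 𝒢.BObj] (h𝒢 : 𝒢.IsConnected) {A Y Y₁ : 𝒢.BObj}
    [PreGaloisCategory.IsConnected Y] [PreGaloisCategory.IsConnected Y₁] (u : Y ⟶ Y₁) (g₁ : Y₁ ⟶ A)
    (e : 𝒢.graph.Edge) (Q : π₀Obj (A.T e)) (β β' : Y₁.fibreData.total.Branch) (hne : β' ≠ β)
    (ha : (Y₁.fibreData.total.abuts β).isSome)
    (ha' : Y₁.fibreData.total.abuts β' = Y₁.fibreData.total.abuts β)
    (hQ : ∀ γ ∈ [β, β'], (⟨𝒢.graph.edgeOf (Y₁.fibreData.proj.branchMap γ),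
        componentUnder (g₁.fT (𝒢.graph.edgeOf (Y₁.fibreData.proj.branchMap γ))) (Y₁.brComp γ)⟩ :
      Σ e, π₀Obj (A.T e)) = ⟨e, Q⟩) :
    ∃ (γ γ' : Y.fibreData.total.Branch), Y.fibreData.proj.branchMap γ = Y₁.fibreData.proj.branchMap β ∧
      γ' ≠ γ ∧ (Y.fibreData.total.abuts γ).isSome ∧
      Y.fibreData.total.abuts γ' = Y.fibreData.total.abuts γ ∧
      (∀ δ ∈ [γ, γ'], (⟨𝒢.graph.edgeOf (Y.fibreData.proj.branchMap δ),
          componentUnder ((u ≫ g₁).fT (𝒢.graph.edgeOf (Y.fibreData.proj.branchMap δ))) (Y.brComp δ)⟩ :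
        Σ e, π₀Obj (A.T e)) = ⟨e, Q⟩) := by
  classical
  obtain ⟨x, hx⟩ := Option.isSome_iff_exists.mp ha
  obtain ⟨v, px⟩ := x
  set p : π₀Obj (Y₁.S v) := (equivShrink _).symm px with hp
  -- a vertex-cell `p̃` of `𝔾_Y` over `p`
  let F₀ := GaloisCategory.getFiberFunctor (𝒢.V v)
  haveI : FiberFunctor (𝒢.ρ v ⋙ F₀) := 𝒢.fiberFunctor_ρ h𝒢 v F₀
  haveI := p.2
  obtain ⟨a₁⟩ := nonempty_fiber_of_isConnected F₀ (p.1 : 𝒢.V v)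
  obtain ⟨xt, hxt⟩ := surjective_of_nonempty_fiber_of_isConnected (𝒢.ρ v ⋙ F₀) u (F₀.map p.1.arrow a₁)
  obtain ⟨pt, ht, hpt⟩ := exists_component_mem_range F₀ (show F₀.obj (Y.S v) from xt)
  obtain ⟨kp₀, hkp₀⟩ := exists_factor_componentUnder (u.fS v) pt
  have hptp : componentUnder (u.fS v) pt = p :=
    component_eq_of_mem_range F₀ _ p (x := F₀.map p.1.arrow a₁)
      ⟨F₀.map kp₀ ht, by rw [← FintypeCat.comp_apply, ← F₀.map_comp, hkp₀, F₀.map_comp,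
        FintypeCat.comp_apply, hpt]; exact hxt⟩ ⟨a₁, rfl⟩
  obtain ⟨kp, hkp⟩ : ∃ kp : (pt.1 : 𝒢.V v) ⟶ (p.1 : 𝒢.V v), kp ≫ p.1.arrow = pt.1.arrow ≫ u.fS v := by
    rw [← hptp]; exact ⟨kp₀, hkp₀⟩
  -- single-cell lift: every branch-cell `δ` abutting to `(v, p)` lifts to one abutting to `(v, p̃)`
  have L : ∀ δ : Y₁.fibreData.total.Branch, Y₁.fibreData.total.abuts δ = some ⟨v, px⟩ →
      ∃ ct : π₀Obj (Y.T (𝒢.graph.edgeOf δ.1)),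
        Y.fibreData.total.abuts ⟨δ.1, equivShrink _ ct⟩ = some ⟨v, equivShrink _ pt⟩ ∧
        componentUnder (u.fT (𝒢.graph.edgeOf δ.1)) ct = Y₁.brComp δ := by
    intro δ hδ
    have h' : 𝒢.graph.abuts δ.1 = some v := abuts_fst hδ
    have hvp : p = Y₁.componentOver δ.1 v h' (Y₁.brComp δ) := vComp_eq_componentOver hδ
    -- identity frame at `(v, δ.1)`
    let Fe := GaloisCategory.getFiberFunctor (𝒢.E (𝒢.graph.edgeOf δ.1))
    let F : 𝒢.V v ⥤ FintypeCat.{v₁} := (𝒢.pull δ.1 v h').pullback ⋙ Fe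
    haveI : FiberFunctor F := fiberFunctor_comp_of_exact _ Fe
    set c : π₀Obj (Y₁.T (𝒢.graph.edgeOf δ.1)) := Y₁.brComp δ with hc
    haveI := c.2
    -- a point `x₁ ∈ F(p)` whose level edge is `c`
    have hle : c.1 ≤ Y₁.branchImage δ.1 v h' p.1 := hvp ▸ Y₁.le_branchImage_componentOver δ.1 v h' c
    haveI := Y₁.mono_map_arrow_comp_ψ δ.1 v h' p.1
    obtain ⟨q⟩ := nonempty_fiber_of_isConnected Fe (c.1 : 𝒢.E (𝒢.graph.edgeOf δ.1))
    let w : F.obj (p.1 : 𝒢.V v) := Fe.map (Subobject.ofLEMk c.1 _ hle) q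
    have hw : Fe.map (Y₁.ψ δ.1 v h').hom (F.map p.1.arrow w) = Fe.map c.1.arrow q := by
      change Fe.map (Y₁.ψ δ.1 v h').hom (Fe.map ((𝒢.pull δ.1 v h').pullback.map p.1.arrow)
        (Fe.map (Subobject.ofLEMk c.1 _ hle) q)) = _
      rw [← FintypeCat.comp_apply, ← FintypeCat.comp_apply, ← Fe.map_comp, ← Fe.map_comp,
        Subobject.ofLEMk_comp]
    -- lift it into `p̃`
    haveI := pt.2
    obtain ⟨wt, hwt⟩ := surjective_of_nonempty_fiber_of_isConnected F kp w
    let xt₁ : F.obj (Y.S v) := F.map pt.1.arrow wt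
    have hxt₁ : F.map (u.fS v) xt₁ = F.map p.1.arrow w := by
      change F.map (u.fS v) (F.map pt.1.arrow wt) = _
      rw [← FintypeCat.comp_apply, ← F.map_comp, ← hkp, F.map_comp, FintypeCat.comp_apply, hwt]
    obtain ⟨ct, hct⟩ := exists_eComp_mem Y F δ.1 h' Fe (Iso.refl _) xt₁
    refine ⟨ct, ?_, ?_⟩
    · have := coveringGraph_abuts_mk Y δ.1 h' ct
      change Y.fibreData.total.abuts _ = _ at this
      rw [this, componentOver_eq_of_mem Y F δ.1 h' Fe (Iso.refl _) hct ⟨wt, rfl⟩]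
    · obtain ⟨q', hq'⟩ := hct
      obtain ⟨k, hk⟩ := exists_factor_componentUnder (u.fT (𝒢.graph.edgeOf δ.1)) ct
      refine component_eq_of_mem_range Fe _ c
        (x := Fe.map (u.fT (𝒢.graph.edgeOf δ.1)) (Fe.map (Y.ψ δ.1 v h').hom xt₁)) ⟨Fe.map k q', ?_⟩ ⟨q, ?_⟩
      · change _ = Fe.map _ (Fe.map (Y.ψ δ.1 v h').hom ((Iso.refl F).inv.app (Y.S v) xt₁))
        rw [← hq', ← FintypeCat.comp_apply, ← FintypeCat.comp_apply, ← Fe.map_comp, ← Fe.map_comp, hk]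
      · rw [← hw, ← hxt₁]
        change (Fe.map ((𝒢.pull δ.1 v h').pullback.map (u.fS v)) ≫ Fe.map (Y₁.ψ δ.1 v h').hom) xt₁ =
          (Fe.map (Y.ψ δ.1 v h').hom ≫ Fe.map (u.fT (𝒢.graph.edgeOf δ.1))) xt₁
        rw [← Fe.map_comp, ← Fe.map_comp, u.comm δ.1 v h']
  -- lift `β` and `β′`
  obtain ⟨b, cb⟩ := β
  obtain ⟨b', cb'⟩ := β'
  obtain ⟨ct, hat, hut⟩ := L ⟨b, cb⟩ hx
  obtain ⟨ct', hat', hut'⟩ := L ⟨b', cb'⟩ (ha'.trans hx)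
  refine ⟨⟨b, equivShrink _ ct⟩, ⟨b', equivShrink _ ct'⟩, rfl, fun heq => hne ?_, by rw [hat]; rfl,
    hat'.trans hat.symm, ?_⟩
  · obtain ⟨hb, hc⟩ := Sigma.mk.inj_iff.mp heq
    change b' = b at hb
    subst hb
    have hcc : ct' = ct := (equivShrink _).injective (eq_of_heq hc)
    have : Y₁.brComp ⟨b', cb'⟩ = Y₁.brComp ⟨b', cb⟩ := by rw [← hut, ← hut', hcc]
    exact congrArg (Sigma.mk b') ((equivShrink _).symm.injective this)
  · have hlift : ∀ (b₂ : 𝒢.graph.Branch) (c₂ : π₀Obj (Y.T (𝒢.graph.edgeOf b₂))) (cb₂ : Shrink.{u} (π₀Obj (Y₁.T (𝒢.graph.edgeOf b₂)))),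
        componentUnder (u.fT (𝒢.graph.edgeOf b₂)) c₂ = Y₁.brComp ⟨b₂, cb₂⟩ →
        (⟨b₂, cb₂⟩ : Y₁.fibreData.total.Branch) ∈ [⟨b, cb⟩, ⟨b', cb'⟩] →
        (⟨𝒢.graph.edgeOf b₂, componentUnder ((u ≫ g₁).fT (𝒢.graph.edgeOf b₂))
          (Y.brComp ⟨b₂, equivShrink _ c₂⟩)⟩ : Σ e, π₀Obj (A.T e)) = ⟨e, Q⟩ := by
      intro b₂ c₂ cb₂ hu₂ hmem
      have h2 := hQ ⟨b₂, cb₂⟩ hmem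
      change (⟨𝒢.graph.edgeOf b₂, componentUnder (u.fT _ ≫ g₁.fT _) ((equivShrink _).symm (equivShrink _ c₂))⟩ :
        Σ e, π₀Obj (A.T e)) = ⟨e, Q⟩
      rw [Equiv.symm_apply_apply, componentUnder_comp, hu₂]
      exact h2
    intro δ hδ
    simp only [List.mem_cons, List.mem_nil_iff, or_false] at hδ
    rcases hδ with rfl | rfl
    exacts [hlift b ct cb hut (by simp), hlift b' ct' cb' hut' (by simp)]

end Literature.AnabelianGeometry.SemiGraphs.SemiGraphOfAnabelioids.BObj
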